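import Summits.BirchSwinnertonDyer.BirchSwinnertonDyer.Theorems.EisensteinPrimesMazurMCOnCellBTwistbackOrderOnePartnerPAdicGZ
import HarnessLib

/-!
# Crux 3 `MazurMCOnCellB` (stmt-BirchSwinnertonDyer-19033), line `twistback` v5/v6 — road (b): the per-pair certificate
# `ord_{T=0} L_p(E^K, T) = 1` READ OFF ONE COEFFICIENT (`‖[T¹](ϖ·L)‖_p > p^{-(k+1)}`), and its door `_of_padicGZ`

Width seat bsd-line-x2-p1-w3 (g11), 2026-08-28; sequel of `…TwistbackOrderOnePartnerPAdicGZ` (this seat, p661229). HONEST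
FRAMING (cell `bsd-eis`, run/shared/lean/pub/bsd-eis/): conditional theorems only; named facts BY NAME — the route's
`PublishedInputs` (stmt-…-19037), Disegni 2020 Thm. 4(1) (`padicBSD_rankOne_nonsplitMult`, PUB) and Disegni 2020 Thm. 2.4
(`padicGrossZagier_nonsplitMult`, PUB, p660151); per pair ONE FINITE `p`-adic reading. No `def`, no `sorry`; nothing about
any curve is proved unconditionally; no main conjecture / BSD; 0 cells / labels / stubs / tiers move.

WHY. Road (b) (LEAD verdicts g11/g12 §2 (ii): the 14 non-split A10 cells with `c(E) ≠ 1`) asks per pair for ONE admissible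
`K` whose twist `E^K` has `ord_{T=0} L_p(E^K, T) = 1` for THE non-split Mazur–Tate–Teitelbaum function (`hordL` of
`…OrderOnePartner{,PAdicGZ}`) — an EXACT order, i.e. `[T⁰] = 0` AND `[T¹] ≠ 0`. The first half is NOT a computation: the
twist has sign `−1` (Heegner), so `L(E^K, 1) = 0` and `[T⁰]L = 2·L(E^K,1)/Ω⁺ = 0` (§1). The second half is a genuine
finite certificate of the same kind the cell already runs for `μ_an` (`X2.AnalyticMuLE`: SOME coefficient of `ϖ·L` has
norm `> p^{-(m+1)}`; kit j311944/j312229): here «the coefficient of `T¹` of `ϖ·L` has norm `> p^{-(k+1)}` for some `k`»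
(§2). So road (b)'s per-pair input is ONE `p`-adic lower bound on ONE modular-symbol sum, and §3 is its door: stub 6′'s
clause at `(W, p)` from that reading, `PublishedInputs`, Disegni Thm. 4(1) and Disegni Thm. 2.4 — PUB + certificate.

* §1 `constantCoeff_eq_zero_of_rootNumber_eq_neg_one` / `…_of_odd_analyticRank` — `[T⁰]L = 0` at a non-split multiplicative
  prime when `w(E) = −1` / `r_an` odd (interpolation `L(0) = 2[0]⁺_f`, `L(E,1) = [0]⁺_f·Ω⁺_f`, `Ω⁺_f > 0`; modularity).
* §2 `order_eq_one_of_odd_of_lt_norm_coeff_one` — `r_an` odd ∧ `p^{-(k+1)} < ‖[T¹](ϖ·L)‖` ⟹ `ord_{T=0} L = 1`; and the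
  `hordL`-shaped packaging `orderOne_of_coeffOneCertificate`.
* §3 `upperPartner_at_of_coeffOne_partner_of_padicGZ` — `…OrderOnePartnerPAdicGZ.upperPartner_at_of_orderOne_partner_of_padicGZ`
  with `hordL` REPLACED by the one-coefficient certificate on every minimal model of the twist (the twist's analytic rank is
  odd inside: `r_an(E) = 0`, Heegner sign).

References: [MazurTateTeitelbaum1986] §I.10, §I.14; [GreenbergLNM1716] §4 (PDF p. 113); [Disegni2020] §2.2 Thm. 2.4, §3.2
Thm. 4; [PerrinRiou1987] §1.4; [BCDTJAMS2001] Thm. A.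
-/

set_option autoImplicit false

-- `Summit.BirchSwinnertonDyer.BirchSwinnertonDyer.…`: the summit and its single sub-problem share a name.
set_option linter.dupNamespace false

noncomputable section

open scoped Classical MatrixGroups ModularForm

open CongruenceSubgroup WeierstrassCurve NumberField IsDedekindDomain Field
  Literature.NumberTheory.EllipticCurves
  Literature.NumberTheory.GaloisRepresentations
  Literature.NumberTheory.EllipticCurves.ModularForms
  Literature.NumberTheory.QuadraticFields
  Literature.NumberTheory.EllipticCurves.Rank1Residual
  Literature.NumberTheory.EllipticCurves.Rank1Residual.Typed
  Literature.NumberTheory.EllipticCurves.Disegni2020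
  Summit.BirchSwinnertonDyer.Rank1Residual
  Summit.BirchSwinnertonDyer.Rank1Residual.X2
  Summit.BirchSwinnertonDyer.BirchSwinnertonDyer.Theses
  Summit.BirchSwinnertonDyer.BirchSwinnertonDyer.Theorems.EisensteinPrimesMazurMCOnCellBTwistbackLamOneRankOne
  Summit.BirchSwinnertonDyer.BirchSwinnertonDyer.Theorems.EisensteinPrimesMazurMCOnCellBTwistbackOrderOnePartnerPAdicGZ

namespace Summit.BirchSwinnertonDyer.BirchSwinnertonDyer.Theorems.EisensteinPrimesMultOrderOneCoeffCertificate

/-! ## §1. The constant term vanishes for sign `−1` — not a computation -/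

/-- **`[T⁰]L_p(E, T) = 0` at a NON-SPLIT multiplicative prime when `w(E) = −1`.** For `W/ℚ` elliptic with
`W.rootNumber = −1`, a newform `f` of `W` and THE non-split Mazur–Tate–Teitelbaum function `L` of `f`
(`IsMultPAdicLFunctionOf f p (−1) L`): `L(0) = 2·[0]⁺_f` (one Euler-type factor, Greenberg LNM 1716 §4) and
`L(E, 1) = [0]⁺_f · Ω⁺_f` with `Ω⁺_f > 0` (`IsNewformOf.entireLFunction_one_eq`), while `L(E, 1) = 0` for sign `−1`
(`entireLFunction_one_eq_zero_of_rootNumber_eq_neg_one`); so `[0]⁺_f = 0` and `L(0) = 0`.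
[cite: MazurTateTeitelbaum1986, §I.14] [cite: GreenbergLNM1716, §4 (PDF p. 113)] -/
theorem constantCoeff_eq_zero_of_rootNumber_eq_neg_one
    (W : WeierstrassCurve ℚ) [W.IsElliptic] (p : ℕ) [Fact p.Prime] (hw : W.rootNumber = -1)
    {N : ℕ} [NeZero N] {f : CuspForm (Gamma0 N) 2} (hf : IsNewformOf W f)
    {L : PowerSeries ℚ_[p]} (hL : IsMultPAdicLFunctionOf f p (-1) L) :
    PowerSeries.constantCoeff L = 0 := by
  have hLE0 : W.entireLFunction 1 = 0 := entireLFunction_one_eq_zero_of_rootNumber_eq_neg_one hw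
  have hsym0 : ratPlusSymbol f 0 = 0 := by
    have h := hf.entireLFunction_one_eq
    rw [hLE0] at h
    have hpos : 0 < plusPeriod f := IsNewform0.plusPeriod_pos_holds hf.1 hf.coeffField_eq_bot
    have h' : (((ratPlusSymbol f 0 : ℚ) : ℝ) * plusPeriod f : ℝ) = 0 := by exact_mod_cast h.symm
    rcases mul_eq_zero.mp h' with h2 | h2
    · exact_mod_cast h2
    · exact absurd h2 hpos.ne'
  rw [hL.constantCoeff_of_neg_one, hsym0]; simp

/-- **`[T⁰]L_p(E, T) = 0` at a non-split multiplicative prime when `ord_{s=1} L(E, s)` is ODD** (modularity: odd rank ⟹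
`w(E) = −1`, `even_analyticRank_iff_rootNumber_eq_one_of_exists_isNewformOf`; then §1). [cite: BCDTJAMS2001, Thm. A]
[cite: MazurTateTeitelbaum1986, §I.14] -/
theorem constantCoeff_eq_zero_of_odd_analyticRank (hnf : exists_isNewformOf)
    (W : WeierstrassCurve ℚ) [W.IsElliptic] (p : ℕ) [Fact p.Prime] (hodd : Odd W.analyticRank)
    {N : ℕ} [NeZero N] {f : CuspForm (Gamma0 N) 2} (hf : IsNewformOf W f)
    {L : PowerSeries ℚ_[p]} (hL : IsMultPAdicLFunctionOf f p (-1) L) :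
    PowerSeries.constantCoeff L = 0 := by
  have hw : W.rootNumber = -1 := by
    rcases rootNumber_eq_one_or_eq_neg_one (W := W) with h | h
    · exact absurd ((even_analyticRank_iff_rootNumber_eq_one_of_exists_isNewformOf W hnf).mpr h)
        (Nat.not_even_iff_odd.mpr hodd)
    · exact h
  exact constantCoeff_eq_zero_of_rootNumber_eq_neg_one W p hw hf hL

/-! ## §2. `ord_{T=0} L = 1` from ONE coefficient reading -/

/-- **`ord_{T=0} L = 1` from the sign and ONE `p`-adic lower bound.** If `[T⁰]L = 0` and the coefficient of `T¹` of `ϖ·L`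
has norm `> p^{-(k+1)}` for some `k` (so it is non-zero, hence `[T¹]L ≠ 0`), then `ord_{T=0} L = 1` exactly. Pure
bookkeeping on `PowerSeries.order`. [folklore] -/
theorem order_eq_one_of_constantCoeff_eq_zero_of_lt_norm_coeff_one {p : ℕ} [Fact p.Prime] {L : PowerSeries ℚ_[p]}
    (h0 : PowerSeries.constantCoeff L = 0) {ϖ : ℚ} {k : ℕ}
    (h1 : (p : ℝ) ^ (-((k : ℤ) + 1)) < ‖PowerSeries.coeff 1 (PowerSeries.C ((ϖ : ℚ) : ℚ_[p]) * L)‖) :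
    L.order = ((1 : ℕ) : ℕ∞) := by
  have hne : PowerSeries.coeff 1 (PowerSeries.C ((ϖ : ℚ) : ℚ_[p]) * L) ≠ 0 := by
    intro h
    rw [h, norm_zero] at h1
    exact not_le.mpr h1 (by positivity)
  have hc1 : PowerSeries.coeff 1 L ≠ 0 := by
    intro h
    apply hne
    rw [PowerSeries.coeff_C_mul, h, mul_zero]
  rw [PowerSeries.order_eq_nat]
  refine ⟨hc1, fun i hi ↦ ?_⟩
  obtain rfl : i = 0 := by omega
  rwa [PowerSeries.coeff_zero_eq_constantCoeff_apply]

/-- **The certificate `hordL` of `…OrderOnePartner{,PAdicGZ}` from ONE coefficient reading per newform/`ϖ`.** For `W/ℚ`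
elliptic of ODD analytic rank at a non-split multiplicative prime `p`: if for every newform `f` of `W`, every `ϖ` with
`ϖ·Ω_E = Ω⁺_f` and THE non-split function `L` the coefficient of `T¹` of `ϖ·L` has norm `> p^{-(k+1)}` for some `k`, then
`ord_{T=0} L = 1` for all such `(f, ϖ, L)` — the `hordL` hypothesis VERBATIM. (Oddness gives `[T⁰] = 0`, §1; the reading
gives `[T¹] ≠ 0`, §2.) [cite: MazurTateTeitelbaum1986, §I.14] [cite: BCDTJAMS2001, Thm. A] -/
theorem orderOne_of_coeffOneCertificate (hnf : exists_isNewformOf)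
    (W : WeierstrassCurve ℚ) [W.IsElliptic] (p : ℕ) [Fact p.Prime] (hodd : Odd W.analyticRank)
    (hC1 : ∀ {N : ℕ} [NeZero N] (f : CuspForm (Gamma0 N) 2), IsNewformOf W f →
      ∀ (ϖ : ℚ), (ϖ : ℝ) * W.realPeriodRat = plusPeriod f →
      ∀ L : PowerSeries ℚ_[p], IsMultPAdicLFunctionOf f p (-1) L →
        ∃ k : ℕ, (p : ℝ) ^ (-((k : ℤ) + 1)) < ‖PowerSeries.coeff 1 (PowerSeries.C ((ϖ : ℚ) : ℚ_[p]) * L)‖) :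
    ∀ {N : ℕ} [NeZero N] (f : CuspForm (Gamma0 N) 2), IsNewformOf W f →
      ∀ (ϖ : ℚ), (ϖ : ℝ) * W.realPeriodRat = plusPeriod f →
      ∀ L : PowerSeries ℚ_[p], IsMultPAdicLFunctionOf f p (-1) L → L.order = ((1 : ℕ) : ℕ∞) := by
  intro N _ f hf ϖ hϖ L hL
  obtain ⟨k, hk⟩ := hC1 f hf ϖ hϖ L hL
  exact order_eq_one_of_constantCoeff_eq_zero_of_lt_norm_coeff_one
    (constantCoeff_eq_zero_of_odd_analyticRank hnf W p hodd hf hL) hk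

/-! ## §3. Road (b), the DOOR from ONE coefficient reading per partner model, PUBLISHED facts only -/

/-- **Stub 6′'s clause AT ONE non-split X2b pair from ONE admissible `K` and ONE `p`-adic coefficient bound on the twist,
PUBLISHED inputs only** — `…OrderOnePartnerPAdicGZ.upperPartner_at_of_orderOne_partner_of_padicGZ` (this seat, p661229)
with its exact-order hypothesis `hordL` REPLACED by the finite reading `hC1`: for every globally minimal model `Wd` of
`E^{(d_K)}`, every newform `f` of `Wd`, `ϖ`, and THE non-split function `L`, SOME `k` with
`p^{-(k+1)} < ‖[T¹](ϖ·L)‖_p`. Inside: `r_an(Wd) = r_an(E^{(d_K)})` is odd (`r_an(E) = 0`, Heegner sign — w5's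
`odd_analyticRank_quadraticTwist_of_analyticRank_eq_zero`, modularity), so §2 turns the reading into `hordL`. This is road
(b)'s door for the non-split cells with `c(E) ≠ 1`: per pair ONE `K` and ONE certified modular-symbol sum; named facts
`PublishedInputs`, Disegni Thm. 4(1), Disegni Thm. 2.4 (all PUB). [cite: Disegni2020, §2.2 Thm. 2.4 and §3.2 Thm. 4]
[cite: MazurTateTeitelbaum1986, §I.14] [cite: PerrinRiou1987, §1.4 Cor. 1.8] [cite: SilvermanAEC2009, VIII.8 Cor. 8.3] -/
theorem upperPartner_at_of_coeffOne_partner_of_padicGZ (hP : EisensteinPrimes.PublishedInputs)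
    (hDis : padicBSD_rankOne_nonsplitMult) (hDGZ : padicGrossZagier_nonsplitMult)
    (W : WeierstrassCurve ℚ) [W.IsElliptic] [W.IsGloballyMinimal] (p : ℕ) [Fact p.Prime]
    (hc : X2.CellB W p) (hns : ¬ W.HasSplitMultiplicativeReductionAtPrime p)
    (K : Type) [Field K] [NumberField K] (hK : IsImaginaryQuadratic K)
    (hHN : SatisfiesHeegnerHypothesis (W.conductorNorm ℤ) K) (hHp : SatisfiesHeegnerHypothesis p K)
    (hodd : Odd (NumberField.discr K)) (hlt : NumberField.discr K < -4)
    (hC1 : ∀ (Wd : WeierstrassCurve ℚ) [Wd.IsElliptic] [Wd.IsGloballyMinimal],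
      (∃ C : VariableChange ℚ, C • Wd = W.quadraticTwist (NumberField.discr K : ℚ)) →
      ∀ {M : ℕ} [NeZero M] (f : CuspForm (Gamma0 M) 2), IsNewformOf Wd f →
      ∀ (ϖ : ℚ), (ϖ : ℝ) * Wd.realPeriodRat = plusPeriod f →
      ∀ L : PowerSeries ℚ_[p], IsMultPAdicLFunctionOf f p (-1) L →
        ∃ k : ℕ, (p : ℝ) ^ (-((k : ℤ) + 1)) < ‖PowerSeries.coeff 1 (PowerSeries.C ((ϖ : ℚ) : ℚ_[p]) * L)‖) :
    ∃ (K : Type) (_ : Field K) (_ : NumberField K), IsImaginaryQuadratic K ∧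
      SatisfiesHeegnerHypothesis (W.conductorNorm ℤ) K ∧ SatisfiesHeegnerHypothesis p K ∧
      Odd (NumberField.discr K) ∧ NumberField.discr K < -4 ∧
      (W.quadraticTwist (NumberField.discr K : ℚ)).analyticRank = 1 ∧
      ∀ (Wd : WeierstrassCurve ℚ) [Wd.IsElliptic] [Wd.IsGloballyMinimal],
        (∃ C : VariableChange ℚ, C • Wd = W.quadraticTwist (NumberField.discr K : ℚ)) →
        MissingUpperBoundAt Wd p := by
  have hnf := hP.2.2.2.2.2.1
  have hr0 : W.analyticRank = 0 := hc.1
  -- every minimal model of the twist has odd analytic rank, so the reading IS `hordL`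
  have hordL : ∀ (Wd : WeierstrassCurve ℚ) [Wd.IsElliptic] [Wd.IsGloballyMinimal],
      (∃ C : VariableChange ℚ, C • Wd = W.quadraticTwist (NumberField.discr K : ℚ)) →
      ∀ {M : ℕ} [NeZero M] (f : CuspForm (Gamma0 M) 2), IsNewformOf Wd f →
      ∀ (ϖ : ℚ), (ϖ : ℝ) * Wd.realPeriodRat = plusPeriod f →
      ∀ L : PowerSeries ℚ_[p], IsMultPAdicLFunctionOf f p (-1) L → L.order = ((1 : ℕ) : ℕ∞) := by
    intro Wd _ _ hWd
    obtain ⟨C, hC⟩ := hWd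
    have hoddd : Odd Wd.analyticRank := by
      have h := congrArg WeierstrassCurve.analyticRank hC
      rw [analyticRank_smul] at h
      rw [h]
      exact EisensteinPrimesMazurMCOnCellBTwistbackLamOneRankOne.odd_analyticRank_quadraticTwist_of_analyticRank_eq_zero
        hnf W hr0 K hK hHN
    intro M _ f hf ϖ hϖ L hL
    exact orderOne_of_coeffOneCertificate hnf Wd p hoddd (fun g hg ϖ' hϖ' L' hL' ↦ hC1 Wd ⟨C, hC⟩ g hg ϖ' hϖ' L' hL')
      f hf ϖ hϖ L hL
  exact EisensteinPrimesMazurMCOnCellBTwistbackOrderOnePartnerPAdicGZ.upperPartner_at_of_orderOne_partner_of_padicGZ hP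
    hDis hDGZ W p hc hns K hK hHN hHp hodd hlt hordL

end Summit.BirchSwinnertonDyer.BirchSwinnertonDyer.Theorems.EisensteinPrimesMultOrderOneCoeffCertificate

end
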